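import Literature.Probability.Percolation.KozmaNitzanPinning
import Summits.CriticalPhenomena.PercolationContinuityZ3.Theorems.PercNearOneGluingNoHeavyLowerTailWorstPairExchangeCex

/-!
# `NoHeavyLowerTail` (crux stmt-CriticalPhenomena-4575), line fat-minority-linear — the MERGING LEMMA
# with a general anchor is FALSE (kernel-checked exact witness)

The "merging lemma" (ML) of `FINDINGS-fat-minority-gen5.md` §2 (route task `nh-dp-fatminority`): for star
vertices `x, y` attached only to a relay set `A ∋ a, b`, pre-FKG admissibility of the anchor `a` for each
star separately — `μ(a ↔ b, x attached) ≤ μ(x ↔ b)` and the same for `y` — would imply admissibility of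
`a` for the merged star (the pair `s(x,y)` pinned open).  The ttrl2 engine census
(`run/shared/lean/ttrl/good2/README.md`, 2026-08-19; 4.9 M exact evaluations, 195 violations) found it
FALSE for a GENERAL anchor; the version with the depth-2 anchor `a† = argmin_{G∖o} μ(· ↔ b)` (MLdag /
GOOD2 / Kozma–Nitzan Question 9 at depth 2) has 0 violations in 6 M exact evaluations and is NOT refuted.

Witness (`Fin 5`): stars `x = 0`, `y = 1`; relays `c = 2`, `a = 3` (anchor), `b = 4`; weights
`w(0,2) = 9/10`, `w(0,4) = 3/10`, `w(1,2) = 7/10`, `w(1,4) = 1/10`, `w(2,3) = 9/10`, `w(3,4) = 1/2`.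
Exactly (64 resp. 128 configurations): `μ(a↔b, x att) = 60729/100000 ≤ μ(x↔b) = 121551/200000`,
`μ(a↔b, y att) = 47669/100000 ≤ μ(y↔b) = 95411/200000`, but with `s(x,y)` pinned open
`μ'(a↔b, X att) = 130411/200000 > μ'(X↔b) = 128999/200000` (margin `+353/50000`).  Here `a ≠ a† = c`.

Contents: the witness lists written out literally (the glued list has `(0,1,1)` prepended), the evaluation
lemma `real_admML` for `{a↔b} ∩ {x attached}` (via `WorstPairExchangeCex.real_eq_wcount`), the identification
the pinning identification, the rational facts by `decide +kernel`, and
the deliverable `not_mergingLemma_generalAnchor`.  No sorries, no definitions, standard axioms.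
-/

namespace Summit.CriticalPhenomena.PercolationContinuityZ3.Theorems

open MeasureTheory
open Literature.Probability.LatticeModels Literature.Probability.Percolation
open Summit.CriticalPhenomena.PercolationContinuityZ3.Theorems.AdditiveGluing.Negative.Cert

namespace MergingLemmaCex

/-- The listed pairs of the witness are distinct. [this file] -/
theorem witML_nodup : (wPairs ([((0 : Fin 5), (2 : Fin 5), (9/10 : ℚ)), (0, 4, 3/10), (1, 2, 7/10), (1, 4, 1/10), (2, 3, 9/10), (3, 4, 1/2)] : List (Fin 5 × Fin 5 × ℚ))).Nodup := by decide

/-- The listed pairs of the glued witness are distinct. [this file] -/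
theorem witMLg_nodup : (wPairs ([((0 : Fin 5), (1 : Fin 5), (1 : ℚ)), (0, 2, 9/10), (0, 4, 3/10), (1, 2, 7/10), (1, 4, 1/10), (2, 3, 9/10), (3, 4, 1/2)] : List (Fin 5 × Fin 5 × ℚ))).Nodup := by decide

/-- The weights of the witness lie in `[0,1]`. [this file] -/
theorem witML_weights : ∀ e ∈ ([((0 : Fin 5), (2 : Fin 5), (9/10 : ℚ)), (0, 4, 3/10), (1, 2, 7/10), (1, 4, 1/10), (2, 3, 9/10), (3, 4, 1/2)] : List (Fin 5 × Fin 5 × ℚ)), 0 ≤ e.2.2 ∧ e.2.2 ≤ 1 := by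
  intro e he
  simp only [List.mem_cons, List.not_mem_nil, or_false] at he
  rcases he with rfl | rfl | rfl | rfl | rfl | rfl <;> norm_num

/-- The weights of the glued witness lie in `[0,1]`. [this file] -/
theorem witMLg_weights : ∀ e ∈ ([((0 : Fin 5), (1 : Fin 5), (1 : ℚ)), (0, 2, 9/10), (0, 4, 3/10), (1, 2, 7/10), (1, 4, 1/10), (2, 3, 9/10), (3, 4, 1/2)] : List (Fin 5 × Fin 5 × ℚ)), 0 ≤ e.2.2 ∧ e.2.2 ≤ 1 := by
  intro e he
  simp only [List.mem_cons, List.not_mem_nil, or_false] at he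
  rcases he with rfl | rfl | rfl | rfl | rfl | rfl | rfl <;> norm_num

/-- Evaluation: `μ({3 ↔ 4} ∩ {x attached to {2,3,4}})` is an exact weighted count. [this file] -/
theorem real_admML {l : List (Fin 5 × Fin 5 × ℚ)} (hnd : (wPairs l).Nodup)
    (hq : ∀ e ∈ l, 0 ≤ e.2.2 ∧ e.2.2 ≤ 1) (x : Fin 5) :
    (prodBernoulli (wOfList l)).real
        ((openConn (3 : Fin 5) (4 : Fin 5) : Set (BondConfig (Fin 5))) ∩
          ⋃ c ∈ ({2, 3, 4} : Finset (Fin 5)), openConn x c) =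
      ((((wtabs 5 l).map fun t => if (t.1.getD 3 0).testBit 4 && ((t.1.getD x 0).testBit 2 ||
        (t.1.getD x 0).testBit 3 || (t.1.getD x 0).testBit 4) then t.2 else 0).sum : ℚ) : ℝ) := by
  refine WorstPairExchangeCex.real_eq_wcount hnd hq
    (fun tb => (tb.getD 3 0).testBit 4 && ((tb.getD x 0).testBit 2 || (tb.getD x 0).testBit 3 ||
      (tb.getD x 0).testBit 4)) _ fun ω => ?_
  simp only [Bool.and_eq_true, Bool.or_eq_true, Set.mem_inter_iff, Finset.set_biUnion_insert,
    Finset.set_biUnion_singleton, Set.mem_union]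
  simp only [← testBit_reachTable_iff_mem_openConn]
  constructor
  · rintro ⟨h1, (h2 | h3) | h4⟩
    · exact ⟨h1, Or.inl h2⟩
    · exact ⟨h1, Or.inr (Or.inl h3)⟩
    · exact ⟨h1, Or.inr (Or.inr h4)⟩
  · rintro ⟨h1, h2 | h3 | h4⟩
    · exact ⟨h1, Or.inl (Or.inl h2)⟩
    · exact ⟨h1, Or.inl (Or.inr h3)⟩
    · exact ⟨h1, Or.inr h4⟩

/-- The exact rational facts: admissibility of `a = 3` for `x = 0` and for `y = 1` in the witness, and its
failure for the glued star. [this file] -/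
theorem factsML :
    ((wtabs 5 ([((0 : Fin 5), (2 : Fin 5), (9/10 : ℚ)), (0, 4, 3/10), (1, 2, 7/10), (1, 4, 1/10), (2, 3, 9/10), (3, 4, 1/2)] : List (Fin 5 × Fin 5 × ℚ))).map fun t => if (t.1.getD 3 0).testBit 4 && ((t.1.getD 0 0).testBit 2 ||
      (t.1.getD 0 0).testBit 3 || (t.1.getD 0 0).testBit 4) then t.2 else 0).sum ≤ wConn (wtabs 5 ([((0 : Fin 5), (2 : Fin 5), (9/10 : ℚ)), (0, 4, 3/10), (1, 2, 7/10), (1, 4, 1/10), (2, 3, 9/10), (3, 4, 1/2)] : List (Fin 5 × Fin 5 × ℚ))) 0 4 ∧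
    ((wtabs 5 ([((0 : Fin 5), (2 : Fin 5), (9/10 : ℚ)), (0, 4, 3/10), (1, 2, 7/10), (1, 4, 1/10), (2, 3, 9/10), (3, 4, 1/2)] : List (Fin 5 × Fin 5 × ℚ))).map fun t => if (t.1.getD 3 0).testBit 4 && ((t.1.getD 1 0).testBit 2 ||
      (t.1.getD 1 0).testBit 3 || (t.1.getD 1 0).testBit 4) then t.2 else 0).sum ≤ wConn (wtabs 5 ([((0 : Fin 5), (2 : Fin 5), (9/10 : ℚ)), (0, 4, 3/10), (1, 2, 7/10), (1, 4, 1/10), (2, 3, 9/10), (3, 4, 1/2)] : List (Fin 5 × Fin 5 × ℚ))) 1 4 ∧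
    wConn (wtabs 5 ([((0 : Fin 5), (1 : Fin 5), (1 : ℚ)), (0, 2, 9/10), (0, 4, 3/10), (1, 2, 7/10), (1, 4, 1/10), (2, 3, 9/10), (3, 4, 1/2)] : List (Fin 5 × Fin 5 × ℚ))) 0 4 <
    ((wtabs 5 ([((0 : Fin 5), (1 : Fin 5), (1 : ℚ)), (0, 2, 9/10), (0, 4, 3/10), (1, 2, 7/10), (1, 4, 1/10), (2, 3, 9/10), (3, 4, 1/2)] : List (Fin 5 × Fin 5 × ℚ))).map fun t => if (t.1.getD 3 0).testBit 4 && ((t.1.getD 0 0).testBit 2 ||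
      (t.1.getD 0 0).testBit 3 || (t.1.getD 0 0).testBit 4) then t.2 else 0).sum := by
  decide +kernel

/-- Gluing the two stars is pinning `s(0,1)` open: the pinned weighting of the witness is the weighting of
the glued witness list. [this file] -/
theorem pin_eq_witMLg :
    pinW (wOfList ([((0 : Fin 5), (2 : Fin 5), (9/10 : ℚ)), (0, 4, 3/10), (1, 2, 7/10), (1, 4, 1/10), (2, 3, 9/10), (3, 4, 1/2)] : List (Fin 5 × Fin 5 × ℚ))) ({s((0 : Fin 5), (1 : Fin 5))} : Set (Sym2 (Fin 5))) {s((0 : Fin 5), (1 : Fin 5))} =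
      wOfList ([((0 : Fin 5), (1 : Fin 5), (1 : ℚ)), (0, 2, 9/10), (0, 4, 3/10), (1, 2, 7/10), (1, 4, 1/10), (2, 3, 9/10), (3, 4, 1/2)] : List (Fin 5 × Fin 5 × ℚ)) := by
  funext e
  rw [pinW_apply]
  by_cases he : e ∈ ({s((0 : Fin 5), (1 : Fin 5))} : Set (Sym2 (Fin 5)))
  · have he' : e = s(0, 1) := he
    subst he'
    simp only [Set.mem_singleton_iff, if_true, wOfList, mkE]
    ext
    simp [Set.projIcc]
  · have he' : e ≠ s(0, 1) := he
    rw [if_neg he]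
    simp only [wOfList, mkE]
    rw [if_neg he']

/-- The stars of the witness are attached to `{2,3,4}` only. [this file] -/
theorem witML_star (x : Fin 5) (hx : x = 0 ∨ x = 1) : ∀ z : Fin 5, z ∉ ({2, 3, 4} : Finset (Fin 5)) →
    wOfList ([((0 : Fin 5), (2 : Fin 5), (9/10 : ℚ)), (0, 4, 3/10), (1, 2, 7/10), (1, 4, 1/10), (2, 3, 9/10), (3, 4, 1/2)] : List (Fin 5 × Fin 5 × ℚ)) s(x, z) = 0 := by
  intro z hz
  apply wOfList_eq_zero
  rcases hx with rfl | rfl <;> fin_cases z <;> simp_all <;> decide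

end MergingLemmaCex

open MergingLemmaCex

/-- **The merging lemma with a general anchor is FALSE.**  Negated statement: "for every finite weighted
graph, relays `A ∋ a, b` and two stars `x ≠ y ∉ A` attached only to `A`, if `μ(a↔b, x att) ≤ μ(x↔b)` and
`μ(a↔b, y att) ≤ μ(y↔b)` (pre-FKG admissibility of `a` for each star; `x att = ⋃_{c∈A} {x ↔ c}`), then
the same holds for the merged star, i.e. under `pinW w {s(x,y)} {s(x,y)}`".  Witness: the list of this file
(`x = 0`, `y = 1`, `A = {2,3,4}`, `a = 3`, `b = 4`; margin `+353/50000`); the anchor is not the depth-2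
anchor (`a† = 2`), and the `a†`-version is not refuted (ttrl2 census, 0/6 M). [this file] -/
theorem not_mergingLemma_generalAnchor :
    ¬ (∀ (n : ℕ) (w : Sym2 (Fin n) → unitInterval) (A : Finset (Fin n)) (x y a b : Fin n),
      x ∉ A → y ∉ A → x ≠ y → a ∈ A → b ∈ A →
      (∀ z : Fin n, z ∉ A → w s(x, z) = 0) → (∀ z : Fin n, z ∉ A → w s(y, z) = 0) →
      (prodBernoulli w).real ((openConn a b : Set (BondConfig (Fin n))) ∩ ⋃ c ∈ A, openConn x c) ≤
        (prodBernoulli w).real (openConn x b) →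
      (prodBernoulli w).real ((openConn a b : Set (BondConfig (Fin n))) ∩ ⋃ c ∈ A, openConn y c) ≤
        (prodBernoulli w).real (openConn y b) →
      (prodBernoulli (pinW w {s(x, y)} {s(x, y)})).real
          ((openConn a b : Set (BondConfig (Fin n))) ∩ ⋃ c ∈ A, openConn x c) ≤
        (prodBernoulli (pinW w {s(x, y)} {s(x, y)})).real (openConn x b)) := by
  intro h
  have hx := h 5 (wOfList ([((0 : Fin 5), (2 : Fin 5), (9/10 : ℚ)), (0, 4, 3/10), (1, 2, 7/10), (1, 4, 1/10), (2, 3, 9/10), (3, 4, 1/2)] : List (Fin 5 × Fin 5 × ℚ))) {2, 3, 4} 0 1 3 4 (by decide) (by decide) (by decide) (by decide) (by decide)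
    (witML_star 0 (Or.inl rfl)) (witML_star 1 (Or.inr rfl))
    (by
      rw [real_admML witML_nodup witML_weights, real_openConn_eq_wConn witML_nodup witML_weights]
      exact_mod_cast factsML.1)
    (by
      rw [real_admML witML_nodup witML_weights, real_openConn_eq_wConn witML_nodup witML_weights]
      exact_mod_cast factsML.2.1)
  rw [pin_eq_witMLg, real_admML witMLg_nodup witMLg_weights,
    real_openConn_eq_wConn witMLg_nodup witMLg_weights] at hx
  exact absurd hx (not_le.2 (by exact_mod_cast factsML.2.2))

end Summit.CriticalPhenomena.PercolationContinuityZ3.Theorems
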